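import Summits.QuantumFields.YangMills.Theorems.PoincareLipschitzSphereRayProjection
import Mathlib.Analysis.InnerProductSpace.Calculus
import Mathlib.Analysis.SpecialFunctions.Sqrt
import Mathlib.Analysis.SpecialFunctions.SmoothTransition
import Mathlib.Analysis.Calculus.MeanValue
import HarnessLib

/-!
# Crux `HistoryTailL` (stmt-QuantumFields-19936 ∕ LINE 25 item stmt-QuantumFields-23533), S1″ row (C) `MinimisingMapCompactness`, (C)-PROOF brick
# (C-b-α) «RAY PROJECTION CALCULUS»: the Hardt–Kinderlehrer–Lin ray projection `π_p` is smooth off the centre with `‖Dπ_p(y)‖ ≤ 6∕‖y − p‖`,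
# `Dπ_p(p) = 0` (junk value), and the REGULARISED FAMILY `N_ε = p + σ(‖y − p‖²∕ε² − 1)·(π_p − p)` (`σ` = `Real.smoothTransition`) is globally
# smooth, equals `π_p` off `B_{√2 ε}(p)` and `p` on `B̄_ε(p)`, is bounded by `3`, and has `‖DN_ε(y)‖ ≤ K∕‖y − p‖` UNIFORMLY in `ε`

Cell `ym3-torus` (YM ladder rung R3 = continuum SU(2) Yang–Mills on T³ — a RUNG, NOT the Clay problem: not d = 4, not infinite volume, not a mass
gap); width seat `ym3-torus-px22` g7, second hand of `ym-ust-19936-w3` g15's (C-b) «HKL PROJECTION IN `W^{1,2}`» (which applies the smooth chain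
rule ✓(CR) to `N_ε ∘ w` and lets `ε → 0` by dominated convergence, consuming exactly the rows below).  Helper `--supports stmt-QuantumFields-23533`;
THEOREMS ONLY (0 `def`, 0 `sorry`, default heartbeats), Mathlib + ✓H-1 `…PoincareLipschitzSphereRayProjection`; any real inner-product space `V`,
centre `‖p‖ ≤ ½`.  THE OBJECTS (spelled out in every statement, as in H-1): `e_y := ‖y − p‖⁻¹•(y − p)`, `s(p,e) := −⟪p,e⟫ + √(⟪p,e⟫² + (1 − ‖p‖²))`,
`π_p y := p + s(p,e_y)•e_y` (with Mathlib's `‖0‖⁻¹ = 0`: `e_p = 0`, `π_p p = p`); `N_ε y := p + Real.smoothTransition (‖y − p‖^2 ∕ ε^2 − 1) • (s(p,e_y)•e_y)`.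

WHAT IS PROVED (ns `…Theorems.PoincareLipschitzSphereRayProjectionCalculus`).
* §1 `π_p`: `rayProj_self`, `norm_rayProj_sub_centre_le` (`≤ 2`), `contDiffAt_rayProj_sub_centre`∕★`contDiffAt_rayProj`
  (`y ≠ p`), ★★`norm_fderiv_rayProj_le` (`‖fderiv ℝ π_p y‖ ≤ 6∕‖y − p‖`, `y ≠ p`; ✓H-1's Lipschitz bound read by `norm_fderiv_le_of_lip'`),
  `not_continuousAt_rayProj`, ★`fderiv_rayProj_centre` (`fderiv ℝ π_p p = 0`).
* §2 `exists_lipschitz_smoothTransition` (`∃ L ≥ 0, |σ a − σ b| ≤ L|a − b|`).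
* §3 `N_ε`: `smoothRayProj_eq_centre` (`‖y − p‖ ≤ ε`), `smoothRayProj_eq_rayProj` (`2ε² ≤ ‖y − p‖²`), `norm_smoothRayProj_le` (`≤ 3`),
  ★`contDiff_smoothRayProj`, `fderiv_smoothRayProj_eq_zero` (`‖y − p‖ < ε`), `fderiv_smoothRayProj_eq_fderiv_rayProj` (`2ε² < ‖y − p‖²`),
  ★★★`exists_norm_fderiv_smoothRayProj_le` (`∃ K ≥ 0, ∀ ε > 0, ∀ y, ‖fderiv ℝ N_ε y‖ ≤ K∕‖y − p‖` — `0` at `y = p` under `0⁻¹ = 0`),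
  ★`exists_norm_fderiv_smoothRayProj_le_const` (`∀ ε > 0, ∃ C, ∀ y, ‖fderiv ℝ N_ε y‖ ≤ C`), and at `ε_n := 1∕(n+1)` the EVENTUAL EQUALITIES at EVERY `y`
  (also `y = p`): ★`eventually_smoothRayProj_eq` (values), ★`eventually_fderiv_smoothRayProj_eq` (derivatives).
HONEST SCOPE.  Calculus of one explicit map; NOTHING here proves (C) `MinimisingMapCompactness`, (RS), S1″, K1, `MeanDeviationL`, `BlockLipschitzL`
or `HistoryTailL`.  YM₃ on T³ is rung R3, not Clay; YM gap NOT proved; no summit statement is proved here.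

References: R. Hardt, D. Kinderlehrer, F.-H. Lin, Comm. Math. Phys. 105 (1986) 547–570 [HardtKinderlehrerLin1986] (§2, the projection device and
its kernel bound `|Dπ_p(y)| ≲ |y − p|⁻¹`).
-/

set_option autoImplicit false

noncomputable section

open scoped InnerProductSpace ContDiff Topology
open RealInnerProductSpace Filter Metric Set

namespace Summit.QuantumFields.YangMills.Theorems.PoincareLipschitzSphereRayProjectionCalculus

open Summit.QuantumFields.YangMills.Theorems.PoincareLipschitzSphereRayProjection

variable {V : Type*} [NormedAddCommGroup V] [InnerProductSpace ℝ V]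

/-! ## §1 The ray projection `π_p`: value at the centre, bounds, smoothness off the centre, the derivative bound -/

/-- `π_p p = p`: with `‖0‖⁻¹ = 0` the direction `e_p` is `0`. [folklore] -/
theorem rayProj_self (p : V) :
    p + (-⟪p, ‖p - p‖⁻¹ • (p - p)⟫ + Real.sqrt (⟪p, ‖p - p‖⁻¹ • (p - p)⟫ ^ 2 + (1 - ‖p‖ ^ 2))) •
        (‖p - p‖⁻¹ • (p - p)) = p := by
  simp

/-- `‖π_p y − p‖ ≤ 2` for `‖p‖ ≤ ½` (the root is in `[0,2]` on unit directions; at `y = p` the difference is `0`).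
[cite: HardtKinderlehrerLin1986, §2] -/
theorem norm_rayProj_sub_centre_le (p y : V) (hp : ‖p‖ ≤ 1 / 2) :
    ‖(p + (-⟪p, ‖y - p‖⁻¹ • (y - p)⟫ + Real.sqrt (⟪p, ‖y - p‖⁻¹ • (y - p)⟫ ^ 2 + (1 - ‖p‖ ^ 2))) •
        (‖y - p‖⁻¹ • (y - p))) - p‖ ≤ 2 := by
  by_cases hy : y = p
  · subst hy; simp
  have hyp : y - p ≠ 0 := sub_ne_zero.mpr hy
  have he : ‖‖y - p‖⁻¹ • (y - p)‖ = 1 := by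
    rw [norm_smul, Real.norm_eq_abs, abs_of_pos (inv_pos.mpr (norm_pos_iff.mpr hyp)),
      inv_mul_cancel₀ (norm_ne_zero_iff.mpr hyp)]
  rw [add_sub_cancel_left, norm_smul, Real.norm_eq_abs, abs_of_nonneg (root_nonneg p _ (hp.trans (by norm_num))), he, mul_one]
  exact root_le_two p _ hp he

/-- The `s(p,e_y)•e_y` part of `π_p` (= `π_p y − p`) is `C^∞` at every `y ≠ p` (`‖p‖ ≤ ½`). [cite: HardtKinderlehrerLin1986, §2] -/
theorem contDiffAt_rayProj_sub_centre (p y : V) (hp : ‖p‖ ≤ 1 / 2) (hy : y ≠ p) {n : WithTop ℕ∞} :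
    ContDiffAt ℝ n (fun y : V => (-⟪p, ‖y - p‖⁻¹ • (y - p)⟫ + Real.sqrt (⟪p, ‖y - p‖⁻¹ • (y - p)⟫ ^ 2 + (1 - ‖p‖ ^ 2))) • (‖y - p‖⁻¹ • (y - p))) y := by
  have hyp : y - p ≠ 0 := sub_ne_zero.mpr hy
  have hsub : ContDiffAt ℝ n (fun y : V => y - p) y := contDiffAt_id.sub contDiffAt_const
  have hnorm : ContDiffAt ℝ n (fun y : V => ‖y - p‖) y := hsub.norm ℝ hyp
  have hinv : ContDiffAt ℝ n (fun y : V => ‖y - p‖⁻¹) y := hnorm.inv (norm_ne_zero_iff.mpr hyp)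
  have he : ContDiffAt ℝ n (fun y : V => ‖y - p‖⁻¹ • (y - p)) y := hinv.smul hsub
  have hin : ContDiffAt ℝ n (fun y : V => ⟪p, ‖y - p‖⁻¹ • (y - p)⟫) y := contDiffAt_const.inner ℝ he
  have hpos : ⟪p, ‖y - p‖⁻¹ • (y - p)⟫ ^ 2 + (1 - ‖p‖ ^ 2) ≠ 0 := by
    have : (0:ℝ) < 1 - ‖p‖ ^ 2 := by nlinarith [norm_nonneg p]
    positivity
  have hsq : ContDiffAt ℝ n (fun y : V => Real.sqrt (⟪p, ‖y - p‖⁻¹ • (y - p)⟫ ^ 2 + (1 - ‖p‖ ^ 2))) y :=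
    ((hin.pow 2).add contDiffAt_const).sqrt hpos
  exact (hin.neg.add hsq).smul he

/-- ★ `π_p` is `C^∞` at every `y ≠ p` (`‖p‖ ≤ ½`: the norm is smooth off `0`, the square root at a point `≥ 3∕4 > 0`).
[cite: HardtKinderlehrerLin1986, §2] -/
theorem contDiffAt_rayProj (p y : V) (hp : ‖p‖ ≤ 1 / 2) (hy : y ≠ p) {n : WithTop ℕ∞} :
    ContDiffAt ℝ n (fun y : V => p + (-⟪p, ‖y - p‖⁻¹ • (y - p)⟫ +
        Real.sqrt (⟪p, ‖y - p‖⁻¹ • (y - p)⟫ ^ 2 + (1 - ‖p‖ ^ 2))) • (‖y - p‖⁻¹ • (y - p))) y :=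
  contDiffAt_const.add (contDiffAt_rayProj_sub_centre p y hp hy)

/-- ★★ **THE KERNEL BOUND `‖Dπ_p(y)‖ ≤ 6∕‖y − p‖`** (`‖p‖ ≤ ½`, `y ≠ p`): H-1's finite-difference Lipschitz bound
`‖π_p y − π_p z‖ ≤ 6‖y − z‖∕‖y − p‖` on the neighbourhood `{z ≠ p}` of `y`, read by `norm_fderiv_le_of_lip'`. [cite: HardtKinderlehrerLin1986, §2] -/
theorem norm_fderiv_rayProj_le (p y : V) (hp : ‖p‖ ≤ 1 / 2) (hy : y ≠ p) :
    ‖fderiv ℝ (fun y : V => p + (-⟪p, ‖y - p‖⁻¹ • (y - p)⟫ +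
        Real.sqrt (⟪p, ‖y - p‖⁻¹ • (y - p)⟫ ^ 2 + (1 - ‖p‖ ^ 2))) • (‖y - p‖⁻¹ • (y - p))) y‖ ≤ 6 / ‖y - p‖ := by
  have hyp0 : 0 < ‖y - p‖ := norm_pos_iff.mpr (sub_ne_zero.mpr hy)
  refine norm_fderiv_le_of_lip' ℝ (by positivity) ?_
  filter_upwards [isOpen_compl_singleton.mem_nhds hy] with z hz
  have h := norm_rayProj_sub_rayProj_le p y z hp hy hz
  rw [norm_sub_rev] at h
  calc _ ≤ 6 * ‖y - z‖ / ‖y - p‖ := h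
    _ = 6 / ‖y - p‖ * ‖z - y‖ := by rw [norm_sub_rev y z]; ring

/-- `π_p` is NOT continuous at the centre (`‖p‖ ≤ ½`, `V` nontrivial): along the ray `p + t•u` (`t > 0`, `‖u‖ = 1`) it is the constant
`p + s(p,u)•u ≠ p = π_p p`. [folklore] -/
theorem not_continuousAt_rayProj (p : V) (hp : ‖p‖ ≤ 1 / 2) {u : V} (hu : ‖u‖ = 1) :
    ¬ ContinuousAt (fun y : V => p + (-⟪p, ‖y - p‖⁻¹ • (y - p)⟫ +
        Real.sqrt (⟪p, ‖y - p‖⁻¹ • (y - p)⟫ ^ 2 + (1 - ‖p‖ ^ 2))) • (‖y - p‖⁻¹ • (y - p))) p := by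
  intro hc
  set f : V → V := fun y : V => p + (-⟪p, ‖y - p‖⁻¹ • (y - p)⟫ +
        Real.sqrt (⟪p, ‖y - p‖⁻¹ • (y - p)⟫ ^ 2 + (1 - ‖p‖ ^ 2))) • (‖y - p‖⁻¹ • (y - p)) with hf
  set c : V := p + (-⟪p, u⟫ + Real.sqrt (⟪p, u⟫ ^ 2 + (1 - ‖p‖ ^ 2))) • u with hcdef
  -- along the ray the map is constant `= c`
  have hray : ∀ t : ℝ, 0 < t → f (p + t • u) = c := by
    intro t ht
    have h1 : p + t • u - p = t • u := add_sub_cancel_left p (t • u)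
    have hn : ‖t • u‖ = t := by rw [norm_smul, Real.norm_eq_abs, abs_of_pos ht, hu, mul_one]
    have he : ‖t • u‖⁻¹ • (t • u) = u := by rw [hn, smul_smul, inv_mul_cancel₀ ht.ne', one_smul]
    simp only [hf, h1, he, hcdef]
  -- the limit along `t → 0⁺` of `f (p + t•u)` is `f p = p` by continuity, and `c` by constancy
  have hpath : Tendsto (fun t : ℝ => p + t • u) (𝓝[>] 0) (𝓝 p) := by
    have : Tendsto (fun t : ℝ => p + t • u) (𝓝 0) (𝓝 (p + (0:ℝ) • u)) :=
      ((continuous_const.add (continuous_id.smul continuous_const)).tendsto 0)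
    rw [zero_smul, add_zero] at this
    exact this.mono_left nhdsWithin_le_nhds
  have hlim1 : Tendsto (fun t : ℝ => f (p + t • u)) (𝓝[>] 0) (𝓝 (f p)) := hc.tendsto.comp hpath
  have hlim2 : Tendsto (fun t : ℝ => f (p + t • u)) (𝓝[>] 0) (𝓝 c) := by
    refine (tendsto_congr' ?_).mpr tendsto_const_nhds
    filter_upwards [self_mem_nhdsWithin] with t ht
    exact hray t ht
  have hfp : f p = p := by rw [hf]; exact rayProj_self p
  have hcp : c = p := by
    have := tendsto_nhds_unique hlim2 hlim1
    rw [this, hfp]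
  -- but `‖c‖ = 1 > ½ ≥ ‖p‖`
  have hc1 : ‖c‖ = 1 := by rw [hcdef]; exact norm_add_root_smul_eq_one p u (hp.trans (by norm_num)) hu
  rw [hcp] at hc1
  linarith

/-- ★ `fderiv ℝ π_p p = 0`: `π_p` is not differentiable at the centre (not even continuous, when `V ≠ 0`), so Mathlib's `fderiv` takes its junk
value `0`; in the trivial space every linear map is `0`. [folklore] -/
theorem fderiv_rayProj_centre (p : V) (hp : ‖p‖ ≤ 1 / 2) :
    fderiv ℝ (fun y : V => p + (-⟪p, ‖y - p‖⁻¹ • (y - p)⟫ +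
        Real.sqrt (⟪p, ‖y - p‖⁻¹ • (y - p)⟫ ^ 2 + (1 - ‖p‖ ^ 2))) • (‖y - p‖⁻¹ • (y - p))) p = 0 := by
  by_cases hV : ∃ v : V, v ≠ 0
  · obtain ⟨v, hv⟩ := hV
    have hu : ‖‖v‖⁻¹ • v‖ = 1 := by
      rw [norm_smul, Real.norm_eq_abs, abs_of_pos (inv_pos.mpr (norm_pos_iff.mpr hv)),
        inv_mul_cancel₀ (norm_ne_zero_iff.mpr hv)]
    refine fderiv_zero_of_not_differentiableAt fun hd => ?_
    exact not_continuousAt_rayProj p hp hu hd.continuousAt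
  · simp only [ne_eq, not_exists, not_not] at hV
    ext w
    rw [hV w]
    simp


/-! ## §2 A Lipschitz constant for `Real.smoothTransition` -/

/-- `Real.smoothTransition` is Lipschitz: its derivative is continuous, vanishes off `[0,1]`, hence is bounded. [folklore] -/
theorem exists_lipschitz_smoothTransition :
    ∃ L : ℝ, 0 ≤ L ∧ ∀ a b : ℝ, |Real.smoothTransition a - Real.smoothTransition b| ≤ L * |a - b| := by
  have hcd : ContDiff ℝ 1 Real.smoothTransition := Real.smoothTransition.contDiff (n := 1)
  have hd : Differentiable ℝ Real.smoothTransition := hcd.differentiable (by simp)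
  have hcont : Continuous (deriv Real.smoothTransition) := hcd.continuous_deriv le_rfl
  obtain ⟨M, hM⟩ := isCompact_Icc.exists_bound_of_continuousOn (hcont.continuousOn (s := Icc (0:ℝ) 1))
  have hbound : ∀ x : ℝ, ‖deriv Real.smoothTransition x‖ ≤ max M 0 := by
    intro x
    by_cases h0 : x < 0
    · have heq : Real.smoothTransition =ᶠ[𝓝 x] fun _ => (0:ℝ) := by
        filter_upwards [Iio_mem_nhds h0] with z hz using Real.smoothTransition.zero_of_nonpos hz.le
      rw [heq.deriv_eq, deriv_const, norm_zero]; exact le_max_right _ _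
    by_cases h1 : 1 < x
    · have heq : Real.smoothTransition =ᶠ[𝓝 x] fun _ => (1:ℝ) := by
        filter_upwards [Ioi_mem_nhds h1] with z hz using Real.smoothTransition.one_of_one_le hz.le
      rw [heq.deriv_eq, deriv_const, norm_zero]; exact le_max_right _ _
    · exact (hM x ⟨not_lt.mp h0, not_lt.mp h1⟩).trans (le_max_left _ _)
  have hlip : LipschitzWith (max M 0).toNNReal Real.smoothTransition := by
    refine lipschitzWith_of_nnnorm_deriv_le hd fun x => ?_
    rw [← NNReal.coe_le_coe, coe_nnnorm, Real.coe_toNNReal _ (le_max_right _ _)]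
    exact hbound x
  refine ⟨max M 0, le_max_right _ _, fun a b => ?_⟩
  have h := hlip.dist_le_mul a b
  rw [Real.dist_eq, Real.dist_eq, Real.coe_toNNReal _ (le_max_right _ _)] at h
  exact h

/-! ## §3 The regularised family `N_ε y = p + σ(‖y − p‖²∕ε² − 1)•(π_p y − p)` -/

/-- `‖π_p y − p‖ = ‖s(p,e_y)•e_y‖ ≤ 2` (`‖p‖ ≤ ½`). [cite: HardtKinderlehrerLin1986, §2] -/
theorem norm_root_smul_dir_le (p y : V) (hp : ‖p‖ ≤ 1 / 2) :
    ‖(-⟪p, ‖y - p‖⁻¹ • (y - p)⟫ + Real.sqrt (⟪p, ‖y - p‖⁻¹ • (y - p)⟫ ^ 2 + (1 - ‖p‖ ^ 2))) • (‖y - p‖⁻¹ • (y - p))‖ ≤ 2 := by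
  have h := norm_rayProj_sub_centre_le p y hp
  rwa [add_sub_cancel_left] at h

/-- `N_ε y = p` on the closed ball `‖y − p‖ ≤ ε` (there `‖y − p‖²∕ε² − 1 ≤ 0`, so `σ = 0`). [folklore] -/
theorem smoothRayProj_eq_centre (p y : V) {ε : ℝ} (hε : 0 < ε) (h : ‖y - p‖ ≤ ε) :
    p + Real.smoothTransition (‖y - p‖ ^ 2 / ε ^ 2 - 1) • ((-⟪p, ‖y - p‖⁻¹ • (y - p)⟫ + Real.sqrt (⟪p, ‖y - p‖⁻¹ • (y - p)⟫ ^ 2 + (1 - ‖p‖ ^ 2))) • (‖y - p‖⁻¹ • (y - p))) = p := by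
  have hx : ‖y - p‖ ^ 2 / ε ^ 2 - 1 ≤ 0 := by
    rw [sub_nonpos, div_le_one (by positivity)]
    exact pow_le_pow_left₀ (norm_nonneg _) h 2
  rw [Real.smoothTransition.zero_of_nonpos hx, zero_smul, add_zero]

/-- `N_ε y = π_p y` off the ball `‖y − p‖² ≥ 2ε²` (there `‖y − p‖²∕ε² − 1 ≥ 1`, so `σ = 1`). [folklore] -/
theorem smoothRayProj_eq_rayProj (p y : V) {ε : ℝ} (hε : 0 < ε) (h : 2 * ε ^ 2 ≤ ‖y - p‖ ^ 2) :
    p + Real.smoothTransition (‖y - p‖ ^ 2 / ε ^ 2 - 1) • ((-⟪p, ‖y - p‖⁻¹ • (y - p)⟫ + Real.sqrt (⟪p, ‖y - p‖⁻¹ • (y - p)⟫ ^ 2 + (1 - ‖p‖ ^ 2))) • (‖y - p‖⁻¹ • (y - p))) = p + (-⟪p, ‖y - p‖⁻¹ • (y - p)⟫ + Real.sqrt (⟪p, ‖y - p‖⁻¹ • (y - p)⟫ ^ 2 + (1 - ‖p‖ ^ 2))) • (‖y - p‖⁻¹ • (y - p)) := by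
  have hx : 1 ≤ ‖y - p‖ ^ 2 / ε ^ 2 - 1 := by
    rw [le_sub_iff_add_le, le_div_iff₀ (by positivity)]
    linarith
  rw [Real.smoothTransition.one_of_one_le hx, one_smul]

/-- THE UNIFORM VALUE BOUND `‖N_ε y‖ ≤ 3` (`‖p‖ ≤ ½`, any `ε`, any `y`): `‖p‖ + σ·‖π_p y − p‖ ≤ ½ + 2`. [folklore] -/
theorem norm_smoothRayProj_le (p y : V) (hp : ‖p‖ ≤ 1 / 2) (ε : ℝ) :
    ‖p + Real.smoothTransition (‖y - p‖ ^ 2 / ε ^ 2 - 1) • ((-⟪p, ‖y - p‖⁻¹ • (y - p)⟫ + Real.sqrt (⟪p, ‖y - p‖⁻¹ • (y - p)⟫ ^ 2 + (1 - ‖p‖ ^ 2))) • (‖y - p‖⁻¹ • (y - p)))‖ ≤ 3 := by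
  have hg := norm_root_smul_dir_le p y hp
  have hσ0 := Real.smoothTransition.nonneg (‖y - p‖ ^ 2 / ε ^ 2 - 1)
  have hσ1 := Real.smoothTransition.le_one (‖y - p‖ ^ 2 / ε ^ 2 - 1)
  calc _ ≤ ‖p‖ + ‖Real.smoothTransition (‖y - p‖ ^ 2 / ε ^ 2 - 1) • ((-⟪p, ‖y - p‖⁻¹ • (y - p)⟫ + Real.sqrt (⟪p, ‖y - p‖⁻¹ • (y - p)⟫ ^ 2 + (1 - ‖p‖ ^ 2))) • (‖y - p‖⁻¹ • (y - p)))‖ := norm_add_le _ _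
    _ = ‖p‖ + Real.smoothTransition (‖y - p‖ ^ 2 / ε ^ 2 - 1) * ‖(-⟪p, ‖y - p‖⁻¹ • (y - p)⟫ + Real.sqrt (⟪p, ‖y - p‖⁻¹ • (y - p)⟫ ^ 2 + (1 - ‖p‖ ^ 2))) • (‖y - p‖⁻¹ • (y - p))‖ := by
        rw [norm_smul, Real.norm_eq_abs, abs_of_nonneg hσ0]
    _ ≤ 1 / 2 + 1 * 2 := add_le_add hp (mul_le_mul hσ1 hg (norm_nonneg _) zero_le_one)
    _ ≤ 3 := by norm_num

/-- `N_ε` agrees with the constant `p` near every point of the OPEN ball `‖y − p‖ < ε`. [folklore] -/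
theorem smoothRayProj_eventuallyEq_const (p y : V) {ε : ℝ} (hε : 0 < ε) (h : ‖y - p‖ < ε) :
    (fun y : V => p + Real.smoothTransition (‖y - p‖ ^ 2 / ε ^ 2 - 1) • ((-⟪p, ‖y - p‖⁻¹ • (y - p)⟫ + Real.sqrt (⟪p, ‖y - p‖⁻¹ • (y - p)⟫ ^ 2 + (1 - ‖p‖ ^ 2))) • (‖y - p‖⁻¹ • (y - p)))) =ᶠ[𝓝 y] fun _ => p := by
  have hopen : IsOpen {z : V | ‖z - p‖ < ε} := isOpen_lt (continuous_id.sub continuous_const).norm continuous_const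
  filter_upwards [hopen.mem_nhds h] with z hz
  exact smoothRayProj_eq_centre p z hε hz.le

/-- `N_ε` agrees with `π_p` near every point of the OPEN exterior `2ε² < ‖y − p‖²`. [folklore] -/
theorem smoothRayProj_eventuallyEq_rayProj (p y : V) {ε : ℝ} (hε : 0 < ε) (h : 2 * ε ^ 2 < ‖y - p‖ ^ 2) :
    (fun y : V => p + Real.smoothTransition (‖y - p‖ ^ 2 / ε ^ 2 - 1) • ((-⟪p, ‖y - p‖⁻¹ • (y - p)⟫ + Real.sqrt (⟪p, ‖y - p‖⁻¹ • (y - p)⟫ ^ 2 + (1 - ‖p‖ ^ 2))) • (‖y - p‖⁻¹ • (y - p)))) =ᶠ[𝓝 y] (fun y : V => p + (-⟪p, ‖y - p‖⁻¹ • (y - p)⟫ + Real.sqrt (⟪p, ‖y - p‖⁻¹ • (y - p)⟫ ^ 2 + (1 - ‖p‖ ^ 2))) • (‖y - p‖⁻¹ • (y - p))) := by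
  have hopen : IsOpen {z : V | 2 * ε ^ 2 < ‖z - p‖ ^ 2} :=
    isOpen_lt continuous_const (((continuous_id.sub continuous_const).norm).pow 2)
  filter_upwards [hopen.mem_nhds h] with z hz
  exact smoothRayProj_eq_rayProj p z hε hz.le

/-- ★ `N_ε` IS GLOBALLY `C^∞` (`‖p‖ ≤ ½`, `ε > 0`): locally the constant `p` on the open ball `‖y − p‖ < ε`; elsewhere `y ≠ p` and every factor is
smooth (`σ`, `‖· − p‖²`, and `s(p,e_y)•e_y` by `contDiffAt_rayProj_sub_centre`). [folklore] -/
theorem contDiff_smoothRayProj (p : V) (hp : ‖p‖ ≤ 1 / 2) {ε : ℝ} (hε : 0 < ε) :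
    ContDiff ℝ ∞ (fun y : V => p + Real.smoothTransition (‖y - p‖ ^ 2 / ε ^ 2 - 1) • ((-⟪p, ‖y - p‖⁻¹ • (y - p)⟫ + Real.sqrt (⟪p, ‖y - p‖⁻¹ • (y - p)⟫ ^ 2 + (1 - ‖p‖ ^ 2))) • (‖y - p‖⁻¹ • (y - p)))) := by
  rw [contDiff_iff_contDiffAt]
  intro y
  by_cases h : ‖y - p‖ < ε
  · exact contDiffAt_const.congr_of_eventuallyEq (smoothRayProj_eventuallyEq_const p y hε h)
  · have hy : y ≠ p := by
      intro hyp; apply h; rw [hyp, sub_self, norm_zero]; exact hε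
    have ht : ContDiffAt ℝ ∞ (fun z : V => Real.smoothTransition (‖z - p‖ ^ 2 / ε ^ 2 - 1)) y := by
      have hx : ContDiffAt ℝ ∞ (fun z : V => ‖z - p‖ ^ 2 / ε ^ 2 - 1) y :=
        (((contDiffAt_id.sub contDiffAt_const).norm_sq ℝ).div_const (ε ^ 2)).sub contDiffAt_const
      exact Real.smoothTransition.contDiffAt.comp y hx
    exact contDiffAt_const.add (ht.smul (contDiffAt_rayProj_sub_centre p y hp hy))

/-- `fderiv ℝ N_ε y = 0` on the open ball `‖y − p‖ < ε` (locally constant there); in particular at `y = p`. [folklore] -/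
theorem fderiv_smoothRayProj_eq_zero (p y : V) {ε : ℝ} (hε : 0 < ε) (h : ‖y - p‖ < ε) :
    fderiv ℝ (fun y : V => p + Real.smoothTransition (‖y - p‖ ^ 2 / ε ^ 2 - 1) • ((-⟪p, ‖y - p‖⁻¹ • (y - p)⟫ + Real.sqrt (⟪p, ‖y - p‖⁻¹ • (y - p)⟫ ^ 2 + (1 - ‖p‖ ^ 2))) • (‖y - p‖⁻¹ • (y - p)))) y = 0 := by
  rw [(smoothRayProj_eventuallyEq_const p y hε h).fderiv_eq]
  exact fderiv_const_apply p

/-- `fderiv ℝ N_ε y = fderiv ℝ π_p y` on the open exterior `2ε² < ‖y − p‖²` (the two maps agree near `y`). [folklore] -/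
theorem fderiv_smoothRayProj_eq_fderiv_rayProj (p y : V) {ε : ℝ} (hε : 0 < ε) (h : 2 * ε ^ 2 < ‖y - p‖ ^ 2) :
    fderiv ℝ (fun y : V => p + Real.smoothTransition (‖y - p‖ ^ 2 / ε ^ 2 - 1) • ((-⟪p, ‖y - p‖⁻¹ • (y - p)⟫ + Real.sqrt (⟪p, ‖y - p‖⁻¹ • (y - p)⟫ ^ 2 + (1 - ‖p‖ ^ 2))) • (‖y - p‖⁻¹ • (y - p)))) y = fderiv ℝ (fun y : V => p + (-⟪p, ‖y - p‖⁻¹ • (y - p)⟫ + Real.sqrt (⟪p, ‖y - p‖⁻¹ • (y - p)⟫ ^ 2 + (1 - ‖p‖ ^ 2))) • (‖y - p‖⁻¹ • (y - p))) y :=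
  (smoothRayProj_eventuallyEq_rayProj p y hε h).fderiv_eq

/-- ★★★ **THE ε-UNIFORM MAJORANT `‖DN_ε(y)‖ ≤ K∕‖y − p‖`** (`‖p‖ ≤ ½`; one `K ≥ 0` for all `ε > 0` and all `y`; at `y = p` both sides are `0` under
`0⁻¹ = 0`).  Three regimes: `‖y − p‖ < ε` (derivative `0`); `‖y − p‖² > 2ε²` (`= Dπ_p`, bound `6∕‖y − p‖`); the collar `ε ≤ ‖y − p‖ ≤ √2·ε`, where
`N_ε z − N_ε y = (σ_z − σ_y)•(π_p z − p) + σ_y•(π_p z − π_p y)` is locally `(10L + 6)∕‖y − p‖`-Lipschitz (`L` = Lipschitz constant of `σ`,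
`|‖z − p‖² − ‖y − p‖²| ≤ ‖z − y‖(‖z − p‖ + ‖y − p‖)`, `‖π_p z − p‖ ≤ 2`, `‖y − p‖∕ε² ≤ 2∕‖y − p‖`, H-1's `6∕‖y − p‖` bound), read by `norm_fderiv_le_of_lip'`.
[cite: HardtKinderlehrerLin1986, §2] -/
theorem exists_norm_fderiv_smoothRayProj_le (p : V) (hp : ‖p‖ ≤ 1 / 2) :
    ∃ K : ℝ, 0 ≤ K ∧ ∀ ε : ℝ, 0 < ε → ∀ y : V,
      ‖fderiv ℝ (fun y : V => p + Real.smoothTransition (‖y - p‖ ^ 2 / ε ^ 2 - 1) • ((-⟪p, ‖y - p‖⁻¹ • (y - p)⟫ + Real.sqrt (⟪p, ‖y - p‖⁻¹ • (y - p)⟫ ^ 2 + (1 - ‖p‖ ^ 2))) • (‖y - p‖⁻¹ • (y - p)))) y‖ ≤ K / ‖y - p‖ := by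
  obtain ⟨L, hL0, hL⟩ := exists_lipschitz_smoothTransition
  refine ⟨6 + 10 * L, by positivity, fun ε hε y => ?_⟩
  by_cases hA : ‖y - p‖ < ε
  · rw [fderiv_smoothRayProj_eq_zero p y hε hA, norm_zero]; positivity
  have hyp0 : 0 < ‖y - p‖ := lt_of_lt_of_le hε (not_lt.mp hA)
  have hy : y ≠ p := fun h => by rw [h, sub_self, norm_zero] at hyp0; exact lt_irrefl _ hyp0
  by_cases hB : 2 * ε ^ 2 < ‖y - p‖ ^ 2
  · rw [fderiv_smoothRayProj_eq_fderiv_rayProj p y hε hB]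
    exact (norm_fderiv_rayProj_le p y hp hy).trans (div_le_div_of_nonneg_right (by linarith) hyp0.le)
  -- the collar `ε ≤ ‖y − p‖`, `‖y − p‖² ≤ 2ε²`
  have hB' : ‖y - p‖ ^ 2 ≤ 2 * ε ^ 2 := not_lt.mp hB
  refine norm_fderiv_le_of_lip' ℝ (by positivity) ?_
  -- neighbourhood: `z ≠ p` and `‖z − y‖ < ‖y − p‖ ∕ 2`
  have hU : {z : V | z ≠ p} ∩ ball y (‖y - p‖ / 2) ∈ 𝓝 y :=
    inter_mem (isOpen_compl_singleton.mem_nhds hy) (ball_mem_nhds y (by positivity))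
  filter_upwards [hU] with z hz
  obtain ⟨hzp, hzy⟩ := hz
  have hzp' : z ≠ p := hzp
  rw [mem_ball, dist_eq_norm] at hzy
  -- abbreviations
  set σz : ℝ := Real.smoothTransition (‖z - p‖ ^ 2 / ε ^ 2 - 1) with hσz
  set σy : ℝ := Real.smoothTransition (‖y - p‖ ^ 2 / ε ^ 2 - 1) with hσy
  set gz : V := (-⟪p, ‖z - p‖⁻¹ • (z - p)⟫ + Real.sqrt (⟪p, ‖z - p‖⁻¹ • (z - p)⟫ ^ 2 + (1 - ‖p‖ ^ 2))) • (‖z - p‖⁻¹ • (z - p)) with hgz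
  set gy : V := (-⟪p, ‖y - p‖⁻¹ • (y - p)⟫ + Real.sqrt (⟪p, ‖y - p‖⁻¹ • (y - p)⟫ ^ 2 + (1 - ‖p‖ ^ 2))) • (‖y - p‖⁻¹ • (y - p)) with hgy
  have hdecomp : (p + σz • gz) - (p + σy • gy) = (σz - σy) • gz + σy • (gz - gy) := by
    rw [sub_smul, smul_sub]; abel
  -- term 1: `|σz − σy|·‖gz‖ ≤ L·|x_z − x_y|·2`
  have hgz2 : ‖gz‖ ≤ 2 := norm_root_smul_dir_le p z hp
  have hσ : |σz - σy| ≤ L * |(‖z - p‖ ^ 2 / ε ^ 2 - 1) - (‖y - p‖ ^ 2 / ε ^ 2 - 1)| := hL _ _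
  have hx : |(‖z - p‖ ^ 2 / ε ^ 2 - 1) - (‖y - p‖ ^ 2 / ε ^ 2 - 1)| = |‖z - p‖ ^ 2 - ‖y - p‖ ^ 2| / ε ^ 2 := by
    rw [show (‖z - p‖ ^ 2 / ε ^ 2 - 1) - (‖y - p‖ ^ 2 / ε ^ 2 - 1) = (‖z - p‖ ^ 2 - ‖y - p‖ ^ 2) / ε ^ 2 by ring,
      abs_div, abs_of_pos (by positivity : (0:ℝ) < ε ^ 2)]
  have hsq : |‖z - p‖ ^ 2 - ‖y - p‖ ^ 2| ≤ ‖z - y‖ * (‖z - p‖ + ‖y - p‖) := by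
    rw [sq_sub_sq, abs_mul, abs_of_nonneg (by positivity : (0:ℝ) ≤ ‖z - p‖ + ‖y - p‖), mul_comm]
    refine mul_le_mul_of_nonneg_right ?_ (by positivity)
    have := abs_norm_sub_norm_le (z - p) (y - p)
    rwa [show z - p - (y - p) = z - y by abel] at this
  have hzp_le : ‖z - p‖ ≤ 3 / 2 * ‖y - p‖ := by
    calc ‖z - p‖ = ‖(z - y) + (y - p)‖ := by congr 1; abel
      _ ≤ ‖z - y‖ + ‖y - p‖ := norm_add_le _ _
      _ ≤ 3 / 2 * ‖y - p‖ := by linarith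
  have hsum : ‖z - p‖ + ‖y - p‖ ≤ 5 / 2 * ‖y - p‖ := by linarith
  -- `‖y − p‖ ∕ ε² ≤ 2 ∕ ‖y − p‖`
  have hcollar : ‖y - p‖ / ε ^ 2 ≤ 2 / ‖y - p‖ := by
    rw [div_le_div_iff₀ (by positivity) hyp0]
    nlinarith
  have hterm1 : ‖(σz - σy) • gz‖ ≤ 10 * L / ‖y - p‖ * ‖z - y‖ := by
    rw [norm_smul, Real.norm_eq_abs]
    calc |σz - σy| * ‖gz‖ ≤ (L * (|‖z - p‖ ^ 2 - ‖y - p‖ ^ 2| / ε ^ 2)) * 2 := by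
          rw [← hx]; exact mul_le_mul hσ hgz2 (norm_nonneg _) (by positivity)
      _ ≤ (L * (‖z - y‖ * (5 / 2 * ‖y - p‖) / ε ^ 2)) * 2 := by
          gcongr
          exact hsq.trans (mul_le_mul_of_nonneg_left hsum (norm_nonneg _))
      _ = 5 * L * (‖y - p‖ / ε ^ 2) * ‖z - y‖ := by ring
      _ ≤ 5 * L * (2 / ‖y - p‖) * ‖z - y‖ := by gcongr
      _ = 10 * L / ‖y - p‖ * ‖z - y‖ := by ring
  -- term 2: `σy·‖gz − gy‖ ≤ 6‖z − y‖∕‖y − p‖`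
  have hσy0 : 0 ≤ σy := Real.smoothTransition.nonneg _
  have hσy1 : σy ≤ 1 := Real.smoothTransition.le_one _
  have hπ : ‖gz - gy‖ ≤ 6 / ‖y - p‖ * ‖z - y‖ := by
    have h := norm_rayProj_sub_rayProj_le p y z hp hy hzp'
    have heq : (p + gy) - (p + gz) = -(gz - gy) := by abel
    rw [heq, norm_neg] at h
    calc ‖gz - gy‖ ≤ 6 * ‖y - z‖ / ‖y - p‖ := h
      _ = 6 / ‖y - p‖ * ‖z - y‖ := by rw [norm_sub_rev y z]; ring
  have hterm2 : ‖σy • (gz - gy)‖ ≤ 6 / ‖y - p‖ * ‖z - y‖ := by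
    rw [norm_smul, Real.norm_eq_abs, abs_of_nonneg hσy0]
    calc σy * ‖gz - gy‖ ≤ 1 * ‖gz - gy‖ := mul_le_mul_of_nonneg_right hσy1 (norm_nonneg _)
      _ ≤ 6 / ‖y - p‖ * ‖z - y‖ := by rw [one_mul]; exact hπ
  calc ‖(p + σz • gz) - (p + σy • gy)‖ = ‖(σz - σy) • gz + σy • (gz - gy)‖ := by rw [hdecomp]
    _ ≤ ‖(σz - σy) • gz‖ + ‖σy • (gz - gy)‖ := norm_add_le _ _
    _ ≤ 10 * L / ‖y - p‖ * ‖z - y‖ + 6 / ‖y - p‖ * ‖z - y‖ := add_le_add hterm1 hterm2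
    _ = (6 + 10 * L) / ‖y - p‖ * ‖z - y‖ := by ring

/-- ★ THE GLOBAL DERIVATIVE BOUND OF EACH `N_ε` ((CR)'s hypothesis): `∀ ε > 0, ∃ C, ∀ y, ‖fderiv ℝ N_ε y‖ ≤ C` (`C = K∕ε`: the derivative vanishes
on `‖y − p‖ < ε` and is `≤ K∕‖y − p‖ ≤ K∕ε` outside). [folklore] -/
theorem exists_norm_fderiv_smoothRayProj_le_const (p : V) (hp : ‖p‖ ≤ 1 / 2) {ε : ℝ} (hε : 0 < ε) :
    ∃ C : ℝ, ∀ y : V, ‖fderiv ℝ (fun y : V => p + Real.smoothTransition (‖y - p‖ ^ 2 / ε ^ 2 - 1) • ((-⟪p, ‖y - p‖⁻¹ • (y - p)⟫ + Real.sqrt (⟪p, ‖y - p‖⁻¹ • (y - p)⟫ ^ 2 + (1 - ‖p‖ ^ 2))) • (‖y - p‖⁻¹ • (y - p)))) y‖ ≤ C := by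
  obtain ⟨K, hK0, hK⟩ := exists_norm_fderiv_smoothRayProj_le p hp
  refine ⟨K / ε, fun y => ?_⟩
  by_cases hA : ‖y - p‖ < ε
  · rw [fderiv_smoothRayProj_eq_zero p y hε hA, norm_zero]; positivity
  · exact (hK ε hε y).trans (div_le_div_of_nonneg_left hK0 hε (not_lt.mp hA))

/-- `2·(1∕(n+1))² < c` for all large `n` (`c > 0`). [folklore] -/
theorem eventually_two_mul_sq_inv_succ_lt {c : ℝ} (hc : 0 < c) :
    ∀ᶠ n : ℕ in atTop, 2 * (1 / ((n:ℝ) + 1)) ^ 2 < c := by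
  have h := (tendsto_one_div_add_atTop_nhds_zero_nat (𝕜 := ℝ)).pow 2
  rw [zero_pow two_ne_zero] at h
  have ht : Tendsto (fun n : ℕ => 2 * (1 / ((n:ℝ) + 1)) ^ 2) atTop (𝓝 0) := by simpa using h.const_mul 2
  exact ht.eventually (eventually_lt_nhds hc)

/-- ★ EVENTUAL EQUALITY OF VALUES along `ε_n := 1∕(n+1)`: at EVERY `y` (including `y = p`, where both sides are `p`),
`N_(ε_n) y = π_p y` for all large `n`. [folklore] -/
theorem eventually_smoothRayProj_eq (p y : V) :
    ∀ᶠ n : ℕ in atTop, p + Real.smoothTransition (‖y - p‖ ^ 2 / (1 / ((n:ℝ) + 1)) ^ 2 - 1) • ((-⟪p, ‖y - p‖⁻¹ • (y - p)⟫ + Real.sqrt (⟪p, ‖y - p‖⁻¹ • (y - p)⟫ ^ 2 + (1 - ‖p‖ ^ 2))) • (‖y - p‖⁻¹ • (y - p))) = p + (-⟪p, ‖y - p‖⁻¹ • (y - p)⟫ + Real.sqrt (⟪p, ‖y - p‖⁻¹ • (y - p)⟫ ^ 2 + (1 - ‖p‖ ^ 2))) • (‖y - p‖⁻¹ • (y -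 p)) := by
  by_cases hy : y = p
  · subst hy
    refine Eventually.of_forall fun n => ?_
    rw [smoothRayProj_eq_centre y y (by positivity) (by rw [sub_self, norm_zero]; positivity), rayProj_self]
  · have hpos : 0 < ‖y - p‖ ^ 2 := by
      have := norm_pos_iff.mpr (sub_ne_zero.mpr hy); positivity
    filter_upwards [eventually_two_mul_sq_inv_succ_lt hpos] with n hn
    exact smoothRayProj_eq_rayProj p y (by positivity) hn.le

/-- ★ EVENTUAL EQUALITY OF DERIVATIVES along `ε_n := 1∕(n+1)`: at EVERY `y` (including `y = p`, where both sides are `0`),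
`fderiv ℝ N_(ε_n) y = fderiv ℝ π_p y` for all large `n` (`‖p‖ ≤ ½`). [folklore] -/
theorem eventually_fderiv_smoothRayProj_eq (p y : V) (hp : ‖p‖ ≤ 1 / 2) :
    ∀ᶠ n : ℕ in atTop, fderiv ℝ (fun y : V => p + Real.smoothTransition (‖y - p‖ ^ 2 / (1 / ((n:ℝ) + 1)) ^ 2 - 1) • ((-⟪p, ‖y - p‖⁻¹ • (y - p)⟫ + Real.sqrt (⟪p, ‖y - p‖⁻¹ • (y - p)⟫ ^ 2 + (1 - ‖p‖ ^ 2))) • (‖y - p‖⁻¹ • (y - p)))) y = fderiv ℝ (fun y : V => p + (-⟪p, ‖y - p‖⁻¹ • (y - p)⟫ + Real.sqrt (⟪p, ‖y - p‖⁻¹ • (y - p)⟫ ^ 2 + (1 - ‖p‖ ^ 2))) • (‖y - p‖⁻¹ • (y - p))) y := by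
  by_cases hy : y = p
  · subst hy
    refine Eventually.of_forall fun n => ?_
    rw [fderiv_smoothRayProj_eq_zero y y (by positivity) (by rw [sub_self, norm_zero]; positivity),
      fderiv_rayProj_centre y hp]
  · have hpos : 0 < ‖y - p‖ ^ 2 := by
      have := norm_pos_iff.mpr (sub_ne_zero.mpr hy); positivity
    filter_upwards [eventually_two_mul_sq_inv_succ_lt hpos] with n hn
    exact fderiv_smoothRayProj_eq_fderiv_rayProj p y (by positivity) hn

end Summit.QuantumFields.YangMills.Theorems.PoincareLipschitzSphereRayProjectionCalculus

end
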